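import Mathlib.FieldTheory.IntermediateField.Adjoin.Basic
import Mathlib.RingTheory.AlgebraicIndependent.AlgebraicClosure
import Mathlib.RingTheory.AlgebraicIndependent.Transcendental
import Literature.FieldTheory.Regular.RacPurelyTranscendental
import HarnessLib

/-!
# Prasad–Rapinchuk, Lemma 7.2: block-wise functions of independent variables are independent

G. Prasad and A. S. Rapinchuk, *On the fields generated by the lengths of closed geodesics in
locally symmetric spaces*, Geom. Dedicata **172** (2014) 79–120 (arXiv:1110.0141), Lemma 7.2:

> Let `F` be a field and `E = F(t₁, …, tₙ)` with `t₁, …, tₙ` algebraically independent over `F`.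
> Let `{1, …, n} = I₁ ∪ ⋯ ∪ I_s` be an arbitrary partition, let `E_j` be the field generated over
> `F` by the `tᵢ`, `i ∈ I_j`, and for each `j` pick `f_j ∈ E_j ∖ F`. Then
> `tr.deg_F F(f₁, …, f_s) = s`.

This is the "simple lemma" that closes the proof of their Proposition 7.1 (transcendence degree of
the field generated by lengths of closed geodesics; see
`Literature/NumberTheory/Transcendental/PrasadRapinchukLengths.lean`). We PROVE it here, in the
form `AlgebraicIndependent F f` (equivalent to `tr.deg_F F(f₁, …, f_s) = s` for a family of `s`
generators), for base fields `F` sitting inside an ambient field `Ω` of characteristic `0`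
(the paper's use: `F = ℚ(B) ⊂ ℝ`), the partition being given by the fibres of a map `c : ι → κ`:

* `Literature.NumberTheory.Transcendental.PrasadRapinchuk.mem_bot_of_mem_adjoin_image_of_disjoint`
  — for `t` algebraically independent over `F` and disjoint `P, Q ⊆ ι`,
  `F(t(P)) ∩ F(t(Q)) = F`;
* `Literature.NumberTheory.Transcendental.PrasadRapinchuk.algebraicIndependent_of_mem_adjoin_fibre`
  — Lemma 7.2.

## Proof

By the finitary criterion `algebraicIndependent_of_finite_type'` it suffices to show that `f_j`
is transcendental over `F[f_k : k ∈ T]` for every finite `T ∌ j`; we show more: `f_j` is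
transcendental over `L = F(tᵢ : c i ∈ T)`. The block `(tᵢ)_{c i = j}` stays algebraically
independent over `L` (`AlgebraicIndependent.adjoin_of_disjoint`), and `f_j ∈ L(tᵢ : c i = j)`; if
`f_j` were algebraic over `L` it would lie in `L` because a field is algebraically closed in a
purely transcendental extension
(`Literature.FieldTheory.Regular.mem_of_isAlgebraic_of_mem_adjoin_of_algebraicIndependent`, the
characteristic-`0` tool that dictates our scope), hence in `F(t(c⁻¹{j})) ∩ F(t(c⁻¹T)) = F`
(first bullet: write `f_j = r/s` with `r, s ∈ F[X]`, lift to `L`-coefficients and compare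
coefficients using independence of the block over `L`) — contradicting `f_j ∉ F`.

Scope: the printed lemma is over an arbitrary field `F`; everything here is for subfields of a
characteristic-zero field, which is what §7 of the paper uses. No definitions are introduced.
-/

noncomputable section

open Set

namespace Literature.NumberTheory.Transcendental

namespace PrasadRapinchuk

variable {F₀ Ω : Type*} [Field F₀] [Field Ω] [Algebra F₀ Ω]

/-- For a family `t` algebraically independent over a subfield `F` and disjoint index sets
`P, Q`, the subfields `F(t(P))` and `F(t(Q))` meet in `F`: an element of both, written `r/s` with
`r, s ∈ F[X_{t(P)}]`, gives the relation `r - x·s = 0` over `L = F(t(Q))` among the `t(P)`, which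
are algebraically independent over `L`, so `r = x·s` coefficientwise and `x ∈ F`. [folklore] -/
theorem mem_bot_of_mem_adjoin_image_of_disjoint (F : IntermediateField F₀ Ω) {ι : Type*}
    {t : ι → Ω} (ht : AlgebraicIndependent F t) {P Q : Set ι} (hPQ : Disjoint P Q) {x : Ω}
    (hxP : x ∈ IntermediateField.adjoin F (t '' P))
    (hxQ : x ∈ IntermediateField.adjoin F (t '' Q)) :
    x ∈ (⊥ : IntermediateField F Ω) := by
  classical
  set L : IntermediateField F Ω := IntermediateField.adjoin F (t '' Q) with hL
  -- the family `Subtype.val : t '' P → Ω` is algebraically independent over `L`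
  have hP : AlgebraicIndependent (Algebra.adjoin F (t '' Q)) (fun i : P => t i) :=
    ht.adjoin_of_disjoint hPQ.symm
  have hP' : AlgebraicIndependent L (fun i : P => t i) :=
    IntermediateField.algebraicIndependent_adjoin_iff.2 hP
  have hPimg : AlgebraicIndependent L (fun y : t '' P => (y : Ω)) := hP'.image
  -- write `x = r / s` with `r, s ∈ F[X_{t '' P}]`
  obtain ⟨r, s, hrs⟩ := (IntermediateField.mem_adjoin_iff F x).1 hxP
  by_cases hs0 : MvPolynomial.aeval (Subtype.val : t '' P → Ω) s = 0
  · rw [hrs, hs0, div_zero]; exact zero_mem _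
  -- lift to `L`-coefficients and use algebraic independence over `L`
  set xL : L := ⟨x, hxQ⟩ with hxL
  set p : MvPolynomial (t '' P) L :=
    MvPolynomial.map (algebraMap F L) r - MvPolynomial.C xL * MvPolynomial.map (algebraMap F L) s
    with hp
  have haeval : MvPolynomial.aeval (Subtype.val : t '' P → Ω) p = 0 := by
    have hx : x * MvPolynomial.aeval (Subtype.val : t '' P → Ω) s =
        MvPolynomial.aeval (Subtype.val : t '' P → Ω) r := by
      rw [hrs, div_mul_cancel₀ _ hs0]
    simp only [hp, map_sub, map_mul, MvPolynomial.aeval_map_algebraMap, MvPolynomial.aeval_C]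
    rw [show (algebraMap L Ω) xL = x from rfl, hx, sub_self]
  have hp0 : p = 0 := (algebraicIndependent_iff.1 hPimg) p haeval
  -- compare coefficients
  have hcoeff : ∀ m, algebraMap F L (r.coeff m) = xL * algebraMap F L (s.coeff m) := by
    intro m
    have := congrArg (MvPolynomial.coeff m) hp0
    simp only [hp, MvPolynomial.coeff_sub, MvPolynomial.coeff_map, MvPolynomial.coeff_C_mul,
      MvPolynomial.coeff_zero, sub_eq_zero] at this
    exact this
  have hs : s ≠ 0 := by
    rintro rfl; simp at hs0
  obtain ⟨m, hm⟩ := MvPolynomial.ne_zero_iff.1 hs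
  have hsm : (algebraMap F Ω) (s.coeff m) ≠ 0 :=
    (map_ne_zero_iff (algebraMap F Ω) (algebraMap F Ω).injective).2 hm
  have hx : x = algebraMap F Ω (r.coeff m) / algebraMap F Ω (s.coeff m) := by
    have h1 : ((algebraMap F L (r.coeff m) : L) : Ω) =
        ((xL * algebraMap F L (s.coeff m) : L) : Ω) := congrArg Subtype.val (hcoeff m)
    rw [eq_div_iff hsm]
    have e1 : ((algebraMap F L (r.coeff m) : L) : Ω) = algebraMap F Ω (r.coeff m) := rfl
    have e2 : ((xL * algebraMap F L (s.coeff m) : L) : Ω) = x * algebraMap F Ω (s.coeff m) :=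
      rfl
    rw [← e1, h1, e2]
  rw [hx]
  exact div_mem (IntermediateField.algebraMap_mem _ _) (IntermediateField.algebraMap_mem _ _)

/-- **Prasad–Rapinchuk 2014, Lemma 7.2** (for subfields of a field of characteristic `0`). Let
`t : ι → Ω` (`ι` finite) be algebraically independent over the subfield `F`, let the blocks of a
partition of `ι` be the fibres of `c : ι → κ`, and for each `j` let `f j` lie in the subfield
`F(tᵢ : c i = j)` generated by the `j`-th block but not in `F`. Then the `f j` are algebraically
independent over `F`, i.e. `tr.deg_F F(f_j : j) = #κ` ("`= s`"). The paper states it for an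
arbitrary field `F`; we prove it for `F` inside an ambient field `Ω` with `CharZero Ω`, the case
used in the proof of their Proposition 7.1 (`F = ℚ(B) ⊂ ℝ`).
[cite: PrasadRapinchuk2013, Lemma 7.2] -/
theorem algebraicIndependent_of_mem_adjoin_fibre [CharZero Ω] (F : IntermediateField F₀ Ω)
    {ι κ : Type*} [Fintype ι] (c : ι → κ) {t : ι → Ω} (ht : AlgebraicIndependent F t)
    (f : κ → Ω) (hf : ∀ j, f j ∈ IntermediateField.adjoin F (t '' (c ⁻¹' {j})))
    (hfF : ∀ j, f j ∉ (⊥ : IntermediateField F Ω)) : AlgebraicIndependent F f := by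
  classical
  refine algebraicIndependent_of_finite_type' (algebraMap F Ω).injective
    fun T _hT _hind j hjT => ?_
  -- `L = F(tᵢ : c i ∈ T)` contains `f k` for all `k ∈ T`
  set L : IntermediateField F Ω := IntermediateField.adjoin F (t '' (c ⁻¹' T)) with hL
  have hfT : Algebra.adjoin F (f '' T) ≤ L.toSubalgebra := by
    rw [Algebra.adjoin_le_iff]
    rintro _ ⟨k, hk, rfl⟩
    have hle : IntermediateField.adjoin F (t '' (c ⁻¹' {k})) ≤ L :=
      IntermediateField.adjoin.mono F _ _
        (Set.image_mono (Set.preimage_mono (Set.singleton_subset_iff.2 hk)))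
    exact hle (hf k)
  -- it suffices that `f j` is transcendental over `L`
  suffices hLt : Transcendental L (f j) from hLt.of_tower_top_of_subalgebra_le hfT
  intro halg
  -- the block `j` is algebraically independent over `L`
  have hdisj : Disjoint (c ⁻¹' T) (c ⁻¹' {j}) := by
    rw [Set.disjoint_left]
    rintro i hi rfl
    exact hjT hi
  have hu : AlgebraicIndependent (Algebra.adjoin F (t '' (c ⁻¹' T)))
      (fun i : (c ⁻¹' ({j} : Set κ)) => t i) :=
    ht.adjoin_of_disjoint hdisj
  have hu' : AlgebraicIndependent L (fun i : (c ⁻¹' ({j} : Set κ)) => t i) :=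
    IntermediateField.algebraicIndependent_adjoin_iff.2 hu
  -- `f j ∈ L(block j)`
  have hmem :
      f j ∈ IntermediateField.adjoin L (Set.range fun i : (c ⁻¹' ({j} : Set κ)) => t i) := by
    have hsub : t '' (c ⁻¹' {j}) ⊆
        (IntermediateField.adjoin L (Set.range fun i : (c ⁻¹' ({j} : Set κ)) => t i) : Set Ω) := by
      rintro _ ⟨i, hi, rfl⟩
      exact IntermediateField.subset_adjoin L _ ⟨⟨i, hi⟩, rfl⟩
    have hle : IntermediateField.adjoin F (t '' (c ⁻¹' {j})) ≤
        (IntermediateField.adjoin L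
          (Set.range fun i : (c ⁻¹' ({j} : Set κ)) => t i)).restrictScalars F :=
      IntermediateField.adjoin_le_iff.2 hsub
    exact hle (hf j)
  -- a field is algebraically closed in a purely transcendental extension: `f j ∈ L`
  have hfjL : f j ∈ L :=
    Literature.FieldTheory.Regular.mem_of_isAlgebraic_of_mem_adjoin_of_algebraicIndependent L _ hu'
      hmem halg
  -- and `F(t(c⁻¹{j})) ∩ F(t(c⁻¹T)) = F`
  exact hfF j (mem_bot_of_mem_adjoin_image_of_disjoint F ht hdisj.symm (hf j) hfjL)

end PrasadRapinchuk

end Literature.NumberTheory.Transcendental
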